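import Literature.NumberTheory.Transcendental.ExpVarietiesDimension
import Literature.RingTheory.KrullDimension.FieldOfDefinition
import Literature.FieldTheory.Regular.RegularExtension
import HarnessLib

/-!
# Ascent of varieties along an extension of algebraically closed fields

For a field extension `E → F` (an `E`-algebra structure on the field `F`) and a Zariski closed
`W ⊆ E^ι`, the **base change** `W_F = Z_F(I_E(W)) ⊆ F^ι` is the `F`-variety cut out by the same
equations. When `E` is algebraically closed (e.g. relatively algebraically closed in the
algebraically closed `F`), the data of Zilber's axioms ascend from `W` to `W_F`: the `E`-points of
`W_F` are `W`; `W_F` is defined over `E`; `I_F(W_F) = I_E(W)·F[X]` is prime when `I_E(W)` is (the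
locus of a generic point over an algebraically closed base is absolutely prime,
`Literature.FieldTheory.Regular.isPrime_map_ker_aeval`); `dim W_F = dim W`
(`Literature.RingTheory.KrullDimension.ringKrullDim_quotient_vanishingIdeal_eq`); and for
`ι = Fin n ⊕ Fin n`, meeting the torus, additive and multiplicative freeness ascend through an
`E`-point. (Rotundity, which needs generic points of the images under integer matrices, is
treated in a separate file.) This is the variety half of the "SGClosed lemma" — `ecl`-closed
E-subfields of Zilber fields satisfy strong exponential-algebraic closedness (Bays–Kirby 2018,
proof of Thm 8.2; Zilber 2005 §5) — where one applies the axiom of the big field to the base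
change of a variety over the closed subfield.

## References

* U. Görtz, T. Wedhorn, *Algebraic Geometry I*, 2nd ed. (2020), Prop. 5.38.
* S. Lang, *Algebra*, GTM 211, VIII §4.
* M. Bays, J. Kirby, Algebra & Number Theory 12 (2018) 493–549: Thm 8.2 (proof).
-/

noncomputable section

open MvPolynomial Set

universe u

namespace Literature.NumberTheory.Transcendental

namespace VarietyAscent

/-! ### Algebraic elements over an algebraically closed field -/

/-- Over an algebraically closed field, algebraic elements of any extension field are rational.
[folklore] -/
theorem mem_range_algebraMap_of_isAlgebraic {E Kr : Type*} [Field E] [IsAlgClosed E] [Field Kr]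
    [Algebra E Kr] {z : Kr} (hz : IsAlgebraic E z) : z ∈ Set.range (algebraMap E Kr) := by
  have hint : IsIntegral E z := hz.isIntegral
  have h1 : (minpoly E z).degree = 1 :=
    IsAlgClosed.degree_eq_one_of_irreducible E (minpoly.irreducible hint)
  exact minpoly.mem_range_of_degree_eq_one E z h1

/-! ### Extensions of prime ideals of polynomial rings over an algebraically closed field -/

section PrimeMap

variable {E : Type u} [Field E] {ι : Type*}

/-- The coordinate ring and function field of a prime ideal, and its generic point (for an
arbitrary index type; cf. `genericPt` for `Fin n ⊕ Fin n`). [folklore] -/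
theorem ker_aeval_genericPoint (P : Ideal (MvPolynomial ι E)) [P.IsPrime] :
    RingHom.ker (aeval (fun j => algebraMap (MvPolynomial ι E ⧸ P) (FractionRing (MvPolynomial ι E ⧸ P))
      (Ideal.Quotient.mk P (X j))) : MvPolynomial ι E →ₐ[E] FractionRing (MvPolynomial ι E ⧸ P)) = P := by
  haveI : IsDomain (MvPolynomial ι E ⧸ P) := Ideal.Quotient.isDomain P
  set A := MvPolynomial ι E ⧸ P
  set L := FractionRing A
  have hφ : (aeval (fun j => algebraMap A L (Ideal.Quotient.mk P (X j))) : MvPolynomial ι E →ₐ[E] L) =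
      (IsScalarTower.toAlgHom E A L).comp (Ideal.Quotient.mkₐ E P) :=
    MvPolynomial.algHom_ext fun j => by simp; rfl
  ext a
  rw [RingHom.mem_ker, hφ]
  change algebraMap A L (Ideal.Quotient.mk P a) = 0 ↔ a ∈ P
  rw [map_eq_zero_iff _ (IsFractionRing.injective A L), Ideal.Quotient.eq_zero_iff_mem]

/-- **Prime ideals of `E[X]` stay prime after extending an algebraically closed field `E`**
(the locus of the generic point over `E` is absolutely prime, Lang VIII §4). [cite: Lang2002, VIII §4] -/
theorem isPrime_map [CharZero E] [IsAlgClosed E] {F : Type*} [Field F] [Algebra E F]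
    (P : Ideal (MvPolynomial ι E)) [P.IsPrime] :
    (P.map (MvPolynomial.map (algebraMap E F))).IsPrime := by
  haveI : IsDomain (MvPolynomial ι E ⧸ P) := Ideal.Quotient.isDomain P
  have h := Literature.FieldTheory.Regular.isPrime_map_ker_aeval (algebraMap E F)
    (fun j => algebraMap (MvPolynomial ι E ⧸ P) (FractionRing (MvPolynomial ι E ⧸ P))
      (Ideal.Quotient.mk P (X j)))
    (fun z hz => mem_range_algebraMap_of_isAlgebraic hz)
  rwa [ker_aeval_genericPoint P] at h

end PrimeMap

/-! ### The base change of a closed set -/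

section BaseChange

variable {E F : Type u} [Field E] [Field F] [Algebra E F] {ι : Type}

/-- **The base change** `W_F = Z_F(I_E(W))` of `W ⊆ E^ι` to `F`. [folklore] -/
def baseChange (F : Type u) [Field F] [Algebra E F] (W : Set (ι → E)) : Set (ι → F) :=
  zeroLocus F (vanishingIdeal E W)

/-- The base change is defined over `E` in the sense of `IsDefinedOver`, for `E` a subfield of `F`.
[folklore] -/
theorem baseChange_eq_zeroLocus (W : Set (ι → E)) :
    baseChange F W = zeroLocus F (vanishingIdeal E W) := rfl

omit [Algebra E F] in
/-- Evaluation at an `E`-point commutes with the embedding. [folklore] -/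
theorem aeval_algebraMap_comp' [Algebra E F] (m : ι → E) (p : MvPolynomial ι E) :
    aeval (algebraMap E F ∘ m) p = algebraMap E F (aeval m p) :=
  aeval_algebraMap_apply F m p

/-- **The `E`-points of `W_F` are `W`** (for `W` closed). [folklore] -/
theorem comp_mem_baseChange_iff {W : Set (ι → E)} (hW : IsZariskiClosed E W) (m : ι → E) :
    (algebraMap E F ∘ m) ∈ baseChange F W ↔ m ∈ W := by
  rw [baseChange, mem_zeroLocus_iff]
  constructor
  · intro h
    obtain ⟨I, hI⟩ := hW
    have : m ∈ zeroLocus E (vanishingIdeal E W) := by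
      rw [mem_zeroLocus_iff]
      intro p hp
      have := h p hp
      rw [aeval_algebraMap_comp', map_eq_zero_iff _ (algebraMap E F).injective] at this
      exact this
    rw [hI] at this ⊢
    exact zeroLocus_anti_mono (le_vanishingIdeal_zeroLocus I) this
  · intro hm p hp
    rw [aeval_algebraMap_comp', (mem_vanishingIdeal_iff.1 hp) m hm, map_zero]

/-- The image of `W` lies in `W_F`. [folklore] -/
theorem image_subset_baseChange {W : Set (ι → E)} (hW : IsZariskiClosed E W) :
    (fun m => algebraMap E F ∘ m) '' W ⊆ baseChange F W := by
  rintro _ ⟨m, hm, rfl⟩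
  exact (comp_mem_baseChange_iff hW m).2 hm

/-- **`I_E(W_F) = I_E(W)`**: the `E`-polynomials vanishing on the base change are those vanishing
on `W` (for `W` closed). [folklore] -/
theorem vanishingIdeal_baseChange_eq {W : Set (ι → E)} (hW : IsZariskiClosed E W) :
    vanishingIdeal E (baseChange F W) = vanishingIdeal E W := by
  refine le_antisymm ?_ (le_vanishingIdeal_zeroLocus _)
  intro p hp
  rw [mem_vanishingIdeal_iff] at hp ⊢
  intro m hm
  have := hp _ ((comp_mem_baseChange_iff hW m).2 hm)
  rwa [aeval_algebraMap_comp', map_eq_zero_iff _ (algebraMap E F).injective] at this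

/-- The base change is the `F`-zero set of the extended ideal `I_E(W)·F[X]`, in particular Zariski
closed over `F`. [folklore] -/
theorem baseChange_eq_zeroLocus_map (W : Set (ι → E)) :
    baseChange F W = zeroLocus F ((vanishingIdeal E W).map (MvPolynomial.map (algebraMap E F))) :=
  (Literature.RingTheory.KrullDimension.zeroLocus_map _).symm

/-- The base change is Zariski closed. [folklore] -/
theorem isZariskiClosed_baseChange (W : Set (ι → E)) : IsZariskiClosed F (baseChange F W) :=
  ⟨_, baseChange_eq_zeroLocus_map W⟩

variable [Finite ι]

/-- **`I_F(W_F) = I_E(W)·F[X]`** when `I_E(W)·F[X]` is prime (Nullstellensatz over the algebraically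
closed `F`). [folklore] -/
theorem vanishingIdeal_baseChange [IsAlgClosed F] {W : Set (ι → E)}
    (hprime : ((vanishingIdeal E W).map (MvPolynomial.map (algebraMap E F))).IsPrime) :
    vanishingIdeal F (baseChange F W) = (vanishingIdeal E W).map (MvPolynomial.map (algebraMap E F)) := by
  rw [baseChange_eq_zeroLocus_map, vanishingIdeal_zeroLocus_eq_radical, hprime.radical]

/-- **The base change of an irreducible closed set over an algebraically closed `E` is irreducible**
(with ideal `I_E(W)·F[X]`). [cite: Lang2002, VIII §4] -/
theorem isIrreducibleClosed_baseChange [CharZero E] [IsAlgClosed E] [IsAlgClosed F] {W : Set (ι → E)}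
    (hW : IsIrreducibleClosed E W) : IsIrreducibleClosed F (baseChange F W) := by
  haveI := hW.2
  have hprime := isPrime_map (F := F) (vanishingIdeal E W)
  exact ⟨isZariskiClosed_baseChange W, by rw [vanishingIdeal_baseChange hprime]; exact hprime⟩

/-- **The base change keeps the dimension**: `dim W_F = dim W`. [cite: GortzWedhorn2020, Prop. 5.38] -/
theorem zariskiDim_baseChange [CharZero E] [IsAlgClosed E] [IsAlgClosed F] {W : Set (ι → E)}
    (hW : IsIrreducibleClosed E W) : zariskiDim F (baseChange F W) = zariskiDim E W := by
  have hirr := isIrreducibleClosed_baseChange (F := F) hW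
  unfold zariskiDim
  have h := Literature.RingTheory.KrullDimension.ringKrullDim_quotient_vanishingIdeal_eq
    (F := F) (W := baseChange F W) (vanishingIdeal E W) rfl hirr.2
  rw [h, vanishingIdeal_baseChange_eq hW.1]

/-- **Points of `W_F` have transcendence degree at most `dim W` over `E`.**
[cite: GortzWedhorn2020, Prop. 5.38] -/
theorem trdeg_adjoin_le_of_mem_baseChange [CharZero E] [IsAlgClosed E] [IsAlgClosed F]
    {W : Set (ι → E)} (hW : IsIrreducibleClosed E W) {d : ℕ} (hd : zariskiDim E W = d)
    {z : ι → F} (hz : z ∈ baseChange F W) :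
    Algebra.trdeg E (Algebra.adjoin E (Set.range z)) ≤ d := by
  have hirr := isIrreducibleClosed_baseChange (F := F) hW
  have hdim : ringKrullDim (MvPolynomial ι F ⧸ vanishingIdeal F (baseChange F W)) = d := by
    have := zariskiDim_baseChange (F := F) hW
    rw [hd] at this
    exact this
  exact Literature.RingTheory.KrullDimension.trdeg_adjoin_le_of_mem (vanishingIdeal E W) rfl
    hirr.2 hdim hz

end BaseChange

/-! ### The torus data: non-emptiness and freeness ascend through an `E`-point -/

section Torus

variable {E F : Type u} [Field E] [Field F] [Algebra E F] {n : ℕ}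

/-- `E`-points of the torus are `F`-points of the torus. [folklore] -/
theorem comp_mem_torusLocus_iff (m : Fin n ⊕ Fin n → E) :
    (algebraMap E F ∘ m) ∈ torusLocus F n ↔ m ∈ torusLocus E n := by
  simp only [torusLocus, Set.mem_setOf_eq, Function.comp_apply,
    map_ne_zero_iff _ (algebraMap E F).injective]

/-- **`W_F` meets the torus** if `W` does. [folklore] -/
theorem baseChange_inter_torusLocus_nonempty {W : Set (Fin n ⊕ Fin n → E)}
    (hW : IsZariskiClosed E W) (hne : (W ∩ torusLocus E n).Nonempty) :
    (baseChange F W ∩ torusLocus F n).Nonempty := by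
  obtain ⟨m, hmW, hmt⟩ := hne
  exact ⟨algebraMap E F ∘ m, (comp_mem_baseChange_iff hW m).2 hmW, (comp_mem_torusLocus_iff m).2 hmt⟩

/-- **Additive freeness ascends**: a constant value of `∑ mᵢ xᵢ` on `W_F ∩ Gⁿ` is attained at an
`E`-point, hence rational over `E`, and then `∑ mᵢ xᵢ` is constant on `W ∩ Gⁿ`. [folklore] -/
theorem isAddFree_baseChange {W : Set (Fin n ⊕ Fin n → E)} (hW : IsZariskiClosed E W)
    (hne : (W ∩ torusLocus E n).Nonempty) (hadd : IsAddFree E n (W ∩ torusLocus E n)) :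
    IsAddFree F n (baseChange F W ∩ torusLocus F n) := by
  intro m hm ⟨c, hc⟩
  obtain ⟨m₀, hm₀W, hm₀t⟩ := hne
  set c₀ : E := ∑ i, (m i : E) * m₀ (Sum.inl i) with hc₀
  have hcc₀ : c = algebraMap E F c₀ := by
    rw [← hc _ ⟨(comp_mem_baseChange_iff hW m₀).2 hm₀W, (comp_mem_torusLocus_iff m₀).2 hm₀t⟩, hc₀]
    simp
  refine hadd m hm ⟨c₀, fun w hw => ?_⟩
  have := hc _ ⟨(comp_mem_baseChange_iff hW w).2 hw.1, (comp_mem_torusLocus_iff w).2 hw.2⟩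
  rw [hcc₀] at this
  apply (algebraMap E F).injective
  rw [← this]
  simp

/-- **Multiplicative freeness ascends**, likewise. [folklore] -/
theorem isMulFree_baseChange {W : Set (Fin n ⊕ Fin n → E)} (hW : IsZariskiClosed E W)
    (hne : (W ∩ torusLocus E n).Nonempty) (hmul : IsMulFree E n (W ∩ torusLocus E n)) :
    IsMulFree F n (baseChange F W ∩ torusLocus F n) := by
  intro m hm ⟨c, hc⟩
  obtain ⟨m₀, hm₀W, hm₀t⟩ := hne
  set c₀ : E := ∏ i, m₀ (Sum.inr i) ^ m i with hc₀
  have hcc₀ : c = algebraMap E F c₀ := by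
    rw [← hc _ ⟨(comp_mem_baseChange_iff hW m₀).2 hm₀W, (comp_mem_torusLocus_iff m₀).2 hm₀t⟩, hc₀]
    simp
  refine hmul m hm ⟨c₀, fun w hw => ?_⟩
  have := hc _ ⟨(comp_mem_baseChange_iff hW w).2 hw.1, (comp_mem_torusLocus_iff w).2 hw.2⟩
  rw [hcc₀] at this
  apply (algebraMap E F).injective
  rw [← this]
  simp

/-- `E`-points of the graph of exponentiation, for an embedding of exponential fields given by the
algebra map. [folklore] -/
theorem comp_mem_expGraph_iff [Literature.ModelTheory.ExponentialFields.ExponentialRing E]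
    [Literature.ModelTheory.ExponentialFields.ExponentialRing F]
    (hexp : ∀ x : E, algebraMap E F (Literature.ModelTheory.ExponentialFields.ExponentialRing.exp x) =
      Literature.ModelTheory.ExponentialFields.ExponentialRing.exp (algebraMap E F x))
    (m : Fin n ⊕ Fin n → E) : (algebraMap E F ∘ m) ∈ expGraph F n ↔ m ∈ expGraph E n := by
  simp only [mem_expGraph_iff, Function.comp_apply, ← hexp,
    (algebraMap E F).injective.eq_iff]

end Torus

end VarietyAscent

end Literature.NumberTheory.Transcendental

end
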